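import Summits.QuantumFields.QCD.Theses.SpectralDefectExtinction
import Summits.QuantumFields.QCD.Theorems.SpectralDefectExtinctionExtinctionBuildsQCDStubIndexAPSubPerLeWindowAux
import Summits.QuantumFields.QCD.Theorems.SpectralDefectExtinctionExtinctionBuildsQCDStubIndexAPSubPerLeWindowAux2
import Literature.MathematicalPhysics.QuantumFieldTheory.QCDPhaseQuenched
import Literature.MathematicalPhysics.QuantumLattice.WilsonDiracAP

/-!
# Stub `stub_indexAPSubPerLeWindow` of line `block-away-the-sign`
(crux `Summit.QuantumFields.QCD.Theses.SpectralDefectExtinction.ExtinctionBuildsQCD`, item stmt-QuantumFields-18064)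

**Weyl comparison of the spectral index across the boundary condition.** With `C₀ = 8π`: for every
torus side `L`, every `SU(3)` gauge field `U` and every bare mass `μ`, the negative-eigenvalue counts of the
Hermitian Wilson–Dirac operators `Γ₅ D_W` with quarks antiperiodic in all four directions (tree
`Literature.MathematicalPhysics.QuantumLattice.wilsonDiracAP U μ = wilsonDirac ρ_{U(3)} (apLift U) μ 1`) and with
periodic quarks differ by at most the number of eigenvalues of the periodic one in `[−C₀/L, C₀/L]`.

Proof.
* (support file `…StubIndexAPSubPerLeWindowAux.lean`) Weyl's inequality in counting form for Hermitian matrices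
  `A`, `B` with `‖B − A‖ ≤ w` (`ℓ²` operator norm): `|n₋(B) − n₋(A)| ≤ #{λ(A) : |λ| ≤ w}` (min–max).
* (support file `…StubIndexAPSubPerLeWindowAux2.lean`) The uniform central twist `e ↦ u · V e`, `u = c • 1`
  (`|c| = 1`), of a `U(3)` field `V`: `W_μ(c·V) = Re c · W_μ(V) + Im c · W_μ(i·V)` for the tree's hopping
  isometries `wilsonHop` (`‖W_μ‖ ≤ 1`), hence `‖Γ₅ D_W(c·V) − Γ₅ D_W(V)‖ ≤ 8|c − 1|`.
* §1 here: the `U(1) ⊂ U(3)` gauge transformation `g(x) = ζ^{Σ_ν t_ν(x)}·1`, `ζ = e^{iπ/L}`, `t_ν(x) ∈ {0,…,L−1}`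
  the representative of `x_ν`, maps the plain lift `unitaryLift U` to the uniformly twisted antiperiodic lift
  `ζ⁻¹ · apLift U` (seam links pick up the extra `ζ^L = −1`); by gauge covariance (`wilsonDirac_gaugeTransform`)
  and since the site-diagonal scalar gauge rotation commutes with `Γ₅`, the Hermitian operators of
  `unitaryLift U` (= the periodic one, `rfl`) and of `ζ⁻¹ · apLift U` have the same characteristic polynomial.
* §2 here: assemble with `|ζ⁻¹ − 1| ≤ π/L`.

References: MontvayMunster1994 §4.2.4 (4.112)–(4.115); Bhatia, Matrix Analysis, Cor. III.2.6.
-/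

noncomputable section

namespace Summit.QuantumFields.QCD.Cruxes.ExtinctionBuildsQCD.BlockAwayTheSign

open scoped BigOperators Topology Classical MeasureTheory Matrix
open Filter MeasureTheory Matrix
open Literature.MathematicalPhysics.QuantumLattice Literature.MathematicalPhysics.AQFT
  Literature.MathematicalPhysics.QuantumFieldTheory
open Summit.QuantumFields.QCD.Theses.SpectralDefectExtinction
open Summit.QuantumFields.QCD.Theses
open Literature.Probability.LatticeModels (TorusSite)

namespace IndexAPSubPer

/-! ## §1 The `U(1)` gauge transformation from the periodic to the twisted antiperiodic lift -/

section Gauge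

variable {L : ℕ}

/-- For a unit complex number `star z = z⁻¹`. -/
theorem star_eq_inv_of_norm_eq_one {z : ℂ} (hz : ‖z‖ = 1) : star z = z⁻¹ := by
  rw [Complex.inv_def, Complex.normSq_eq_norm_sq, hz, one_pow, inv_one, Complex.ofReal_one, mul_one,
    Complex.star_def]

/-- Representatives under `x ↦ x + 1` on `ℤ/Lℤ`: `t(x+1) = t(x) + 1` off the last slice `x = −1`, where
it drops by `L − 1`. -/
theorem val_add_one_ite [NeZero L] (z : ZMod L) :
    ((z + 1 : ZMod L).val : ℤ) = if z = -1 then (z.val : ℤ) + 1 - L else (z.val : ℤ) + 1 := by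
  obtain ⟨n, hn⟩ : ∃ n, L = n + 1 := Nat.exists_eq_succ_of_ne_zero (NeZero.ne L)
  subst hn
  split_ifs with h
  · subst h
    rw [neg_add_cancel, ZMod.val_zero, ZMod.val_neg_one]
    push_cast
    ring
  · have hne : z.val ≠ n := by
      intro hv
      apply h
      apply ZMod.val_injective
      rw [hv, ZMod.val_neg_one]
    have hlt : z.val < n := lt_of_le_of_ne (Nat.lt_succ_iff.mp (ZMod.val_lt z)) hne
    rcases n with _ | n
    · exact absurd hlt (Nat.not_lt_zero _)
    · have h1 : (1 : ZMod (n + 1 + 1)).val = 1 := by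
        rw [ZMod.val_one_eq_one_mod]
        exact Nat.mod_eq_of_lt (by omega)
      rw [ZMod.val_add_of_lt (by rw [h1]; omega), h1]
      push_cast
      ring

/-- The integer weight `Σ_ν t_ν` of the shifted site `x + μ̂`. -/
theorem sum_val_shift [NeZero L] (x : TorusSite 4 L) (μ : Fin 4) :
    (∑ ν, (((Site.shift x μ) ν).val : ℤ)) =
      if x μ = -1 then (∑ ν, ((x ν).val : ℤ)) + 1 - L else (∑ ν, ((x ν).val : ℤ)) + 1 := by
  have hν : ∀ ν, (((Site.shift x μ) ν).val : ℤ) =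
      (x ν).val + if ν = μ then (((x μ + 1 : ZMod L)).val : ℤ) - (x μ).val else 0 := by
    intro ν
    by_cases h : ν = μ
    · subst h
      simp [Site.shift]
    · simp [Site.shift, h]
  rw [Finset.sum_congr rfl fun ν _ => hν ν, Finset.sum_add_distrib, Finset.sum_ite_eq' Finset.univ μ,
    if_pos (Finset.mem_univ μ), val_add_one_ite]
  split_ifs <;> ring

/-- **The phase drop along a link** for `ζ` with `|ζ| = 1`, `ζ^L = −1` and the site phases
`φ(x) = ζ^{Σ_ν t_ν(x)}`: `φ(x) · conj φ(x + μ̂) = ζ⁻¹` off the seam and `−ζ⁻¹` on the seam `x_μ = −1` (where the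
representative wraps around and `ζ^L = −1` appears). -/
theorem phase_mul_star_phase_shift [NeZero L] {ζ : ℂ} (hζ1 : ‖ζ‖ = 1) (hζL : ζ ^ L = -1)
    (x : TorusSite 4 L) (μ : Fin 4) :
    ζ ^ (∑ ν, ((x ν).val : ℤ)) * star (ζ ^ (∑ ν, (((Site.shift x μ) ν).val : ℤ))) =
      if x μ = -1 then -ζ⁻¹ else ζ⁻¹ := by
  have hζ0 : ζ ≠ 0 := fun h => by rw [h, norm_zero] at hζ1; exact zero_ne_one hζ1
  rw [star_zpow₀, star_eq_inv_of_norm_eq_one hζ1, _root_.inv_zpow', ← zpow_add₀ hζ0, sum_val_shift]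
  split_ifs with h
  · have : (∑ ν, ((x ν).val : ℤ)) + -((∑ ν, ((x ν).val : ℤ)) + 1 - (L : ℤ)) = (L : ℤ) - 1 := by ring
    rw [this, zpow_sub₀ hζ0, zpow_natCast, hζL, zpow_one, neg_div, one_div]
  · have : (∑ ν, ((x ν).val : ℤ)) + -((∑ ν, ((x ν).val : ℤ)) + 1) = -1 := by ring
    rw [this, _root_.zpow_neg_one]

/-- **A `U(1)` gauge transformation maps the plain `U(3)` lift to the uniformly twisted antiperiodic lift**:
if `g(x) = ζ^{Σ_ν t_ν(x)} · 1` and `u = ζ⁻¹ · 1` then `(unitaryLift U)^g = (e ↦ u · apLift U e)`. -/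
theorem gaugeTransform_unitaryLift_eq_twist_apLift [NeZero L] {ζ : ℂ} (hζ1 : ‖ζ‖ = 1) (hζL : ζ ^ L = -1)
    (g : TorusSite 4 L → Matrix.unitaryGroup (Fin 3) ℂ)
    (hg : ∀ x, (g x : Matrix (Fin 3) (Fin 3) ℂ) = ζ ^ (∑ ν, ((x ν).val : ℤ)) • 1)
    (u : Matrix.unitaryGroup (Fin 3) ℂ) (hu : (u : Matrix (Fin 3) (Fin 3) ℂ) = ζ⁻¹ • 1)
    (U : GaugeConfig 4 L SU3) :
    gaugeTransform g (unitaryLift U) = fun e => u * apLift U e := by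
  funext e
  obtain ⟨x, μ⟩ := e
  apply Subtype.ext
  have key := phase_mul_star_phase_shift hζ1 hζL x μ
  rw [gaugeTransform, apLift_apply, ← Unitary.star_eq_inv]
  simp only [Submonoid.coe_mul, Unitary.coe_star, hg, hu, star_smul, star_one,
    Matrix.smul_mul, Matrix.mul_smul, Matrix.one_mul, Matrix.mul_one, smul_smul]
  rw [mul_comm, key]
  split_ifs with h
  · rw [Unitary.coe_neg, smul_neg, neg_smul]
  · rfl

/-- The gauge rotation of a scalar gauge function `g(x) = φ(x) · 1` is the site-diagonal phase matrix. -/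
theorem gaugeRotation_eq_diagonal (g : TorusSite 4 L → Matrix.unitaryGroup (Fin 3) ℂ)
    (φ : TorusSite 4 L → ℂ) (hg : ∀ x, (g x : Matrix (Fin 3) (Fin 3) ℂ) = φ x • 1) :
    gaugeRotation (unitaryFundamentalRep (Fin 3) ℂ) (Fin 4) g =
      Matrix.diagonal fun p : TorusSite 4 L × Fin 3 × Fin 4 => φ p.1 := by
  ext p q
  simp only [gaugeRotation, Matrix.of_apply, Matrix.diagonal_apply, unitaryFundamentalRep_apply, hg,
    Matrix.smul_apply, Matrix.one_apply, smul_eq_mul, Prod.ext_iff]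
  by_cases h1 : p.1 = q.1 <;> by_cases h2 : p.2.1 = q.2.1 <;> by_cases h3 : p.2.2 = q.2.2 <;>
    simp [h1, h2, h3]

/-- A scalar gauge rotation commutes with `Γ₅` (both are diagonal). -/
theorem spinorLift_gammaFive_mul_gaugeRotation [NeZero L]
    (g : TorusSite 4 L → Matrix.unitaryGroup (Fin 3) ℂ) (φ : TorusSite 4 L → ℂ)
    (hg : ∀ x, (g x : Matrix (Fin 3) (Fin 3) ℂ) = φ x • 1) :
    (spinorLift gammaFive : Matrix (TorusSite 4 L × Fin 3 × Fin 4) (TorusSite 4 L × Fin 3 × Fin 4) ℂ) *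
        gaugeRotation (unitaryFundamentalRep (Fin 3) ℂ) (Fin 4) g =
      gaugeRotation (unitaryFundamentalRep (Fin 3) ℂ) (Fin 4) g * spinorLift gammaFive := by
  rw [gaugeRotation_eq_diagonal g φ hg, spinorLift_gammaFive_eq_diagonal, diagonal_mul_diagonal,
    diagonal_mul_diagonal]
  congr 1
  funext p
  ring

/-- **Same characteristic polynomial**: for `ζ` with `|ζ| = 1`, `ζ^L = −1` and `u = ζ⁻¹ · 1`, the Hermitian
Wilson–Dirac operators of the plain lift `unitaryLift U` and of the uniformly twisted antiperiodic lift
`e ↦ u · apLift U e` are unitarily equivalent by a site-diagonal scalar gauge rotation (which commutes with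
`Γ₅`). -/
theorem charpoly_hermitian_twist_apLift [NeZero L] {ζ : ℂ} (hζ1 : ‖ζ‖ = 1) (hζL : ζ ^ L = -1)
    (u : Matrix.unitaryGroup (Fin 3) ℂ) (hu : (u : Matrix (Fin 3) (Fin 3) ℂ) = ζ⁻¹ • 1)
    (U : GaugeConfig 4 L SU3) (m : ℝ) :
    (spinorLift gammaFive *
        wilsonDirac (unitaryFundamentalRep (Fin 3) ℂ) (fun e => u * apLift U e) m 1).charpoly =
      (spinorLift gammaFive * wilsonDirac (unitaryFundamentalRep (Fin 3) ℂ) (unitaryLift U) m 1).charpoly := by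
  -- the scalar gauge function `g(x) = ζ^{Σ_ν t_ν(x)} · 1`
  let g : TorusSite 4 L → Matrix.unitaryGroup (Fin 3) ℂ := fun x =>
    ⟨ζ ^ (∑ ν, ((x ν).val : ℤ)) • 1,
      smul_one_mem_unitaryGroup (by rw [norm_zpow, hζ1, _root_.one_zpow])⟩
  have hg : ∀ x, (g x : Matrix (Fin 3) (Fin 3) ℂ) = ζ ^ (∑ ν, ((x ν).val : ℤ)) • 1 := fun x => rfl
  set G := gaugeRotation (unitaryFundamentalRep (Fin 3) ℂ) (Fin 4) g with hG
  set G' := gaugeRotation (unitaryFundamentalRep (Fin 3) ℂ) (Fin 4) g⁻¹ with hG'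
  have hGG : G' * G = 1 := gaugeRotation_inv_mul _ _
  have hcomm : spinorLift gammaFive * G = G * spinorLift gammaFive :=
    spinorLift_gammaFive_mul_gaugeRotation g _ hg
  rw [← gaugeTransform_unitaryLift_eq_twist_apLift hζ1 hζL g hg u hu, wilsonDirac_gaugeTransform, ← hG,
    ← hG']
  set D := wilsonDirac (unitaryFundamentalRep (Fin 3) ℂ) (unitaryLift U) m 1 with hD
  calc (spinorLift gammaFive * (G * D * G')).charpoly
      = ((G * (spinorLift gammaFive * D)) * G').charpoly := by
        rw [← Matrix.mul_assoc, ← Matrix.mul_assoc, hcomm, Matrix.mul_assoc G]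
    _ = (G' * (G * (spinorLift gammaFive * D))).charpoly := Matrix.charpoly_mul_comm _ _
    _ = (spinorLift gammaFive * D).charpoly := by rw [← Matrix.mul_assoc, hGG, Matrix.one_mul]

/-- The periodic operator in `U(3)` clothing: `D_W(ρ_{U(3)}, unitaryLift U) = D_W(ρ_{SU(3)}, U)` (entrywise
the same matrices). -/
theorem wilsonDirac_unitaryLift (U : GaugeConfig 4 L SU3) (m : ℝ) :
    wilsonDirac (unitaryFundamentalRep (Fin 3) ℂ) (unitaryLift U) m 1 =
      wilsonDirac (fundamentalRep (Fin 3)) U m 1 := rfl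

end Gauge

/-! ## §2 Assembly -/

section Assembly

variable {L : ℕ} [NeZero L]

/-- `ζ = exp(iπ/L)` has `|ζ| = 1`, `ζ^L = −1` and `|ζ⁻¹ − 1| ≤ π/L` (chord ≤ arc). -/
theorem zeta_spec :
    ‖Complex.exp (Complex.I * ((Real.pi / L : ℝ) : ℂ))‖ = 1 ∧
      Complex.exp (Complex.I * ((Real.pi / L : ℝ) : ℂ)) ^ L = -1 ∧
        ‖(Complex.exp (Complex.I * ((Real.pi / L : ℝ) : ℂ)))⁻¹ - 1‖ ≤ Real.pi / L := by
  refine ⟨Complex.norm_exp_I_mul_ofReal _, ?_, ?_⟩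
  · rw [← Complex.exp_nat_mul, ← Complex.exp_pi_mul_I]
    congr 1
    have hL : (L : ℂ) ≠ 0 := Nat.cast_ne_zero.mpr (NeZero.ne L)
    push_cast
    field_simp
  · have h : (Complex.exp (Complex.I * ((Real.pi / L : ℝ) : ℂ)))⁻¹ =
        Complex.exp (Complex.I * ((-(Real.pi / L) : ℝ) : ℂ)) := by
      rw [← Complex.exp_neg]
      congr 1
      push_cast
      ring
    rw [h]
    refine Real.norm_exp_I_mul_ofReal_sub_one_le.trans (le_of_eq ?_)
    rw [norm_neg, Real.norm_eq_abs, abs_of_nonneg (by positivity)]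

open scoped Matrix.Norms.L2Operator in
/-- **The index comparison, configuration-wise** (integer form): with `H^{AP} = Γ₅ D_W^{AP}(U, μ)` and
`H^{per} = Γ₅ D_W(U, μ, 1)`, `|n₋(H^{AP}) − n₋(H^{per})| ≤ #{λ(H^{per}) : |λ| ≤ 8π/L}`. -/
theorem abs_negCount_AP_sub_per_le (U : GaugeConfig 4 L SU3) (μ : ℝ) :
    |((Multiset.countP (fun z : ℂ => z.re < 0)
          (spinorLift gammaFive * Literature.MathematicalPhysics.QuantumLattice.wilsonDiracAP U μ).charpoly.roots : ℕ) : ℤ) -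
        (Multiset.countP (fun z : ℂ => z.re < 0)
          (spinorLift gammaFive * wilsonDirac (fundamentalRep (Fin 3)) U μ 1).charpoly.roots : ℕ)| ≤
      (Multiset.countP (fun z : ℂ => |z.re| ≤ 8 * Real.pi / L)
          (spinorLift gammaFive * wilsonDirac (fundamentalRep (Fin 3)) U μ 1).charpoly.roots : ℕ) := by
  have hρ : ∀ g, unitaryFundamentalRep (Fin 3) ℂ g ∈ Matrix.unitaryGroup (Fin 3) ℂ :=
    unitaryFundamentalRep_mem_unitaryGroup
  obtain ⟨hζ1, hζL, hζsub⟩ := zeta_spec (L := L)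
  set ζ : ℂ := Complex.exp (Complex.I * ((Real.pi / L : ℝ) : ℂ)) with hζ
  -- the central element `u = ζ⁻¹ · 1 ∈ U(3)` and the twisted antiperiodic lift
  let u : Matrix.unitaryGroup (Fin 3) ℂ :=
    ⟨ζ⁻¹ • 1, smul_one_mem_unitaryGroup (by rw [norm_inv, hζ1, inv_one])⟩
  have hu : (u : Matrix (Fin 3) (Fin 3) ℂ) = ζ⁻¹ • 1 := rfl
  have hA : (spinorLift gammaFive *
      wilsonDirac (unitaryFundamentalRep (Fin 3) ℂ) (fun e => u * apLift U e) μ 1).IsHermitian :=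
    Literature.Barriers.QuantumFields.WilsonDeterminant.isHermitian_hermitianWilsonDirac _ hρ _ μ 1
  have hB : (spinorLift gammaFive *
      wilsonDirac (unitaryFundamentalRep (Fin 3) ℂ) (apLift U) μ 1).IsHermitian :=
    Literature.Barriers.QuantumFields.WilsonDeterminant.isHermitian_hermitianWilsonDirac _ hρ (apLift U) μ 1
  have hnorm : ‖spinorLift gammaFive * wilsonDirac (unitaryFundamentalRep (Fin 3) ℂ) (apLift U) μ 1 -
      spinorLift gammaFive *
        wilsonDirac (unitaryFundamentalRep (Fin 3) ℂ) (fun e => u * apLift U e) μ 1‖ ≤ 8 * Real.pi / L := by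
    rw [norm_sub_rev]
    calc _ ≤ 8 * ‖ζ⁻¹ - 1‖ := norm_hermitianWilsonDirac_twist_sub_le u _ hu (apLift U) μ
      _ ≤ 8 * (Real.pi / L) := by gcongr
      _ = 8 * Real.pi / L := by ring
  have hweyl := abs_negCount_sub_le_windowCount_of_opNorm_le hA hB hnorm
  rw [charpoly_hermitian_twist_apLift hζ1 hζL u hu, wilsonDirac_unitaryLift] at hweyl
  exact hweyl

omit [NeZero L] in
/-- Casting an integer comparison of natural numbers to the reals. -/
theorem abs_sub_le_real_of_int {a b c : ℕ} (h : |(a : ℤ) - b| ≤ c) : |(a : ℝ) - b| ≤ c := by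
  have h' := (Int.cast_le (R := ℝ)).mpr h
  push_cast at h'
  exact h'

end Assembly

end IndexAPSubPer

/-! ## The registered stub -/

/-- **Stub W — Weyl comparison of the spectral index across the boundary condition (provable now).** There is an
absolute constant `C₀ > 0` such that for every torus side `L`, every `SU(3)` gauge field `U` and every bare mass `μ`, the
negative-eigenvalue counts of the Hermitian Wilson–Dirac operators with quarks ANTIPERIODIC IN ALL FOUR DIRECTIONS
(tree `Literature.MathematicalPhysics.QuantumLattice.wilsonDiracAP U μ = wilsonDirac ρ_{U(3)} (apLift U) μ 1`, seams on the
links leaving the slices `x_ν = −1`; `wilsonDiracAP_def`, `rfl`) and with periodic quarks differ by at most the number of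
eigenvalues of the PERIODIC one in `[−C₀/L, C₀/L]`. Mechanism: `wilsonDirac ρ U μ 1 = wilsonDirac ρ_{U(3)} (unitaryLift U) μ 1`
entrywise; the `U(1) ⊂ U(3)` lattice gauge transformation `g(x) = exp(iπ Σ_ν t_ν(x)/L)·1` (`t_ν(x) ∈ {0,…,L−1}` the
representative of `x_ν`) maps `unitaryLift U` to the UNIFORMLY twisted field `e^{−iπ/L} · apLift U` (every link times the
scalar `e^{−iπ/L}`, seam links picking up the extra `e^{iπ} = −1`); gauge covariance `wilsonDirac_gaugeTransform`
(tree, `WilsonFermionBlockAveraging`) makes `Γ₅D_W(unitaryLift U)` and `Γ₅D_W(e^{−iπ/L}·apLift U)` unitarily equivalent by a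
site-diagonal scalar unitary (which commutes with `Γ₅ ⊗ 1`), so they have the same root counts; and
`D_W(e^{−iθ}·V) − D_W(V)` has entrywise row/column `ℓ¹` sums `≤ 4·6·|e^{iθ} − 1| ≤ 24 θ` (per direction: `½·|e^{iθ}−1|·2·3`
for each of the two hops; `|γ| ≤ 1`, `|V_ab| ≤ 1`), a quadratic-form bound `|Re v†(A−B)v| ≤ (24π/L) Σ‖v‖²`; Weyl's
inequality in counting form (min–max; tree `Negative.ChiralInertia.card_le_card_eigenvalues_of_form_pos`,
`countP_roots_charpoly_eq_card`; cf. the cdisprove lemma `abs_negCount_sub_le_windowCount_of_form`, Disproof.lean §6a′)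
bounds `|n₋(A) − n₋(B)|` by the window count of `B`. So `C₀ = 24π` works. [MontvayMunster1994 §4.2.4 (4.112)–(4.115);
Bhatia, Matrix Analysis, Cor. III.2.6] -/
theorem stub_indexAPSubPerLeWindow :
    ∃ C₀ : ℝ, 0 < C₀ ∧ ∀ (L : ℕ) [NeZero L] (U : GaugeConfig 4 L SU3) (μ : ℝ),
      |((Multiset.countP (fun z : ℂ => z.re < 0)
            (spinorLift gammaFive * Literature.MathematicalPhysics.QuantumLattice.wilsonDiracAP U μ).charpoly.roots : ℝ) -
        (Multiset.countP (fun z : ℂ => z.re < 0)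
            (spinorLift gammaFive * wilsonDirac (fundamentalRep (Fin 3)) U μ 1).charpoly.roots : ℝ))| ≤
      (Multiset.countP (fun z : ℂ => |z.re| ≤ C₀ / L)
          (spinorLift gammaFive * wilsonDirac (fundamentalRep (Fin 3)) U μ 1).charpoly.roots : ℝ) := by
  refine ⟨8 * Real.pi, by positivity, fun L _ U μ => ?_⟩
  exact IndexAPSubPer.abs_sub_le_real_of_int (IndexAPSubPer.abs_negCount_AP_sub_per_le U μ)

end Summit.QuantumFields.QCD.Cruxes.ExtinctionBuildsQCD.BlockAwayTheSign

end
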